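import Mathlib
import HarnessLib
import HarnessLib.Audit
import Summits.AtomisticToContinuum.Statement

/-!
Route: AmplitudeAnalyticity

CLOSED (retired) 2026-08-15T13:38:27Z by operator:999:1257524 — reason: not-a-thesis: assembly does not conclude the sub-problem Statement — note: D-0027 §2.1 audit (human 2026-08-15: routes that do not decide the summit are removed): the assembly concludes `Literature.MathematicalPhysics.KineticTheory.HydrodynamicLimit`, not the sub-problem statement; a NEW conforming route may be opened from the same idea (generated `closes : … → _root_.Hydr. The file is kept as the record of this route; refuted decls are indexed as negative knowledge (`ledger negatives`).

# Route AmplitudeAnalyticity — N-uniform analyticity in the local-Gibbs tilt amplitude plus a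
near-equilibrium anchor give Euler up to the shock by Vitali

It suffices to show X = A ∧ B ∧ V ∧ C (card amplitude-analyticity-transfer, its economical form
(A1)+(B1') named by the triage).
Embed the datum in a real-analytic one-parameter family of local Gibbs laws ψ_δ, δ ∈ [0,1], from
global equilibrium (δ = 0) to the
target profiles (δ = 1), pre-shock on [0,T'). A (UniformAmplitudeAnalyticity): the time-t MEANS
m_N(δ) = E_ψ_δ[∫ w dμ^emp(Φ_t z)] of
one-body empirical observables extend, uniformly in N, to bounded holomorphic functions of δ on a
fixed complex neighbourhood of [0,1]
("no dynamical Lee–Yang zeros before the shock"). B (NearEquilibriumLimit): the hydrodynamic limit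
holds for the small-amplitude members
δ < δ₁ of such a family. V (FieldVarianceBound): tested fields keep CLT-size fluctuations, (N+1)·Var
≤ C, along C¹ pre-shock paths.
C (AnalyticPreShockPaths, PDE): every classical hs-Euler solution and t < T admit an analytic path
of pre-shock data from a constant
state to its data. Vitali–Montel on a horn-shaped domain over [0,1) plus equicontinuity at δ = 1
(from V) turn B into the limit at δ = 1.
Lean: `UniformAmplitudeAnalyticity ∧ NearEquilibriumLimit ∧ FieldVarianceBound ∧
AnalyticPreShockPaths`

## Assembly
Given A, B, V, C, S, L, fix continuous positive profiles (a₀, θ₀, u₀) with two-sided bound B₀; put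
B₁ = 4B₀² (data bound via S),
B₃ = 16B₀² (path-profile bound via S's inverse bounds) and σ₀ = min of the σ₀'s of S(B₃), C(B₁),
A(B₃), B(B₃), V(B₃). For σ < σ₀, a
classical solution on [0,T), flows Φ, matching at t = 0 and t < T: (1) S identifies the data, ρ(0) =
R(e^μ a₀), u(0) = u₀, θ(0) = θ₀
(uniqueness of limits in probability under probability measures; continuous functions with equal
integrals against all continuous χ
coincide), ∫ρ(0) = 1, bounds B₁. (2) C gives T' ∈ (t,T] and the family; profiles a_δ := Rinv ∘
ρ^δ(0), θ_δ := θ^δ(0), u_δ := u^δ(0)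
are analytic on [0,1) × 𝕋³, C¹ on [0,1] × 𝕋³, constant at 0, within B₃, LLN-matched for every δ by S
(μ_δ = 0 by strict monotonicity
of μ ↦ ∫R(e^μ a_δ)), and a_1 = e^μ a₀, so ψ[a_1, u₀, θ₀] = ψ[a₀, u₀, θ₀] (canonicalDensity is
invariant under a ↦ c·a). (3) For each
δ₂ < 1 the reparametrised sub-path δ ↦ (·)_(δ₂δ) satisfies the frames of A and B: A gives bounded
holomorphic extensions g_N of the
means on a convex complex neighbourhood of [0,1]; B (δ < δ₁) with V (eVar ≤ C/(N+1), Chebyshev)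
gives convergence of the means on a real
interval; L gives a holomorphic limit; the identity theorem on [0,δ₂] against the δ-analytic tested
Euler fields of C identifies it:
m_N(δ') → Euler value for every δ' < 1, for w = χ, χ·v_i, χ|v|²/2. (4) Endpoint: d/dδ m_N =
(N+1)·Cov_ψ_δ(W_t∘Φ_t, ∂_δ log-density
field) is bounded uniformly in N by V at times t and 0 (Cauchy–Schwarz), so m_N is equi-Lipschitz on
[0,1]; with continuity of the
Euler fields in δ at 1 (C, joint C¹), m_N(1) → Euler value at δ = 1, i.e. for (ρ, u, θ)(t). (5) V at
δ = 1 and Chebyshev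
(meas_ge_le_evariance_div_sq), coordinatewise for the momentum field, give TendstoHydroFieldsAt
under ψ[a₀, u₀, θ₀] at time t.
Standard reductions only: Bochner/evariance bookkeeping, energy of B ≥ 1 bounds, identity theorem
(AnalyticOnNhd.eqOn_of_preconnected_of_eventuallyEq).

Rationale: WHY THIS LINE. Mechanism: complex analyticity in the AMPLITUDE of the initial local-Gibbs tilt, with
the invariant Gibbs law as base point, and
Vitali's convergence theorem as the engine carrying identification from near to far from equilibrium
— the dynamical twin of the
static transfer Ruelle1969 §5.1 (proof of Thm 5.1.3: uniformly bounded (P^N)^(1/N), convergent for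
real z ⇒ Vitali) and of
LebowitzPenrose1968, run on Spohn's tilt-differentiation identity Spohn1991 §7.1 (7.16)–(7.18)
BACKWARDS (Spohn differentiates the
local-equilibrium expectation in the tilt λ at λ = 0 and interchanges ε → 0 with ∂_λ without proof;
A is exactly the N-uniformity
that licenses all such interchanges, to all orders and up to λ = O(1)). Imported area:
one-complex-variable normal families
(Vitali–Porter/Montel, identity theorem) and Lee–Yang zero-free regions (LeeYang1952, Ruelle1969 Thm
4.2.3) — never used on the
deterministic hydrodynamic-limit problem (OllaVaradhanYau1993, Yau1991 are entropy methods;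
TothValko2003 and DoyonEtAl2023 treat
Euler-scale fluctuations, not transfer). New for this problem and recorded in the cruxes: (i) since
tested classical Euler fields are
generically NOT real-analytic in the amplitude for non-analytic data (characteristics invert a
smooth non-analytic map), N-uniform
amplitude analyticity can only hold along paths analytic in (δ, x) — hence A is stated on
Torus.stLift-analytic paths and the
conjunct's smooth endpoint is reached through sub-paths [0,δ₂], δ₂ ↑ 1, and an equicontinuity step
paid by V; (ii) the PDE input is
isolated as C (propagation of analyticity AlinhacMetivier1984, Kato1975/Majda1984 continuous
dependence, lifespan Sideris1985).
Versus the five open routes (entropy + ergodicity, cumulant expansion at fixed density, compactness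
+ weak–strong uniqueness, vanishing
noise, chaotic mixing): all estimate the non-equilibrium law at δ = 1 directly; this line never does
— it asks for an N-uniform
zero-free region plus the near-equilibrium limit, and competes as a large-from-small transfer with
card first-failure-blowup (scaling
covariance) while sharing its need for a small-data theorem (B).

RANKED CRUXES. #2 UniformAmplitudeAnalyticity (crux) — (card A1, weakest sufficient form) For
profile bounds B ≥ 1 there is σ₀(B) such that for σ < σ₀, every path of local-Gibbs profiles (a, u,
θ)_δ jointly real-analytic in (δ, x) on [0,1] × 𝕋³ (through Torus.stLift) within the bounds, every
family of classical hs-Euler solutions on [0,T') LLN-matched to it at time 0 for all δ ∈ [0,1],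
every flow family, every t < T' and every continuous one-body observable w with |w(x,v)| ≤
C_w(1+|v|²): there are r > 0 and M such that for every N the mean δ ↦ E_ψ_δ^N[∫ w dμ^emp(Φ^N_t z)]
is the restriction to [0,1] of a holomorphic function bounded by M on the r-neighbourhood of [0,1] ⊂
ℂ. [difficulty: open-problem] (why it might fail: an N-uniform COMPLEX-tilt large-deviation
statement over ≍N^(1/3) collision times: a real pinch of zeros of δ ↦ E_G[e^Λ(δ) W_t] (dynamical
phase transition, hidden slow mode) before T' kills it; the δ-radius must shrink with the
x-analyticity radius, so no smoothness-blind expansion proves it.) [Ruelle1969, LeeYang1952,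
LebowitzPenrose1968, Spohn1991, DoyonEtAl2023, OllaVaradhanYau1993]
#3 NearEquilibriumLimit (crux) — (card B1') Same frame as UniformAmplitudeAnalyticity plus constant
profiles at δ = 0 (global equilibrium): there is δ₁ > 0 such that for every δ ∈ [0, δ₁) and every t
< T' the empirical density, momentum and energy fields at time t converge in probability
(TendstoHydroFieldsAt) under ψ_δ^N to the matched classical Euler solution — the conjunct restricted
to small-amplitude analytic perturbations of global equilibrium. [difficulty: open-problem] (why it
might fail: still a hydrodynamic limit for deterministic hard spheres: needs decay over N^(1/3)
collision times of the non-hydrodynamic part of a small perturbation of Gibbs (no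
linear-response/spectral theorem for the N-body Liouvillian at fixed σ; even Spohn1991 (7.13) is
open); a hidden slow mode breaks it.) [Spohn1991, OllaVaradhanYau1993, Yau1991, TothValko2003,
DoyonEtAl2023]
#4 FieldVarianceBound (crux) — For profile bounds B ≥ 1 there is σ₀(B) such that for σ < σ₀, along
every path of profiles jointly C¹ in (δ, x) on [0,1] × 𝕋³ within the bounds, with a family of
classical solutions on [0,T') LLN-matched for all δ and jointly C¹ in (δ, s, x) on [0,1] × [0,t] ×
𝕋³, for every t ∈ [0,T') and growth constant C_w there is C with (N+1)·eVar_ψ_δ^N(∫ w dμ^emp(Φ^N_t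
z)) ≤ C for all continuous w with |w| ≤ C_w(1+|v|²), all N and all δ ∈ [0,1]: CLT-size fluctuations
of one-body empirical observables persist to Euler times, uniformly along compact C¹ pre-shock
families (at t = 0 or δ = 0 this is statics by invariance of the Gibbs law). [difficulty:
open-problem] (why it might fail: for δ > 0 no change-of-measure argument survives (dψ_δ/dG ~
e^(O(δN))); an instability of the Euler background amplifying thermal noise beyond N^(-1/2), or
anomalous growth of dynamical correlations at fixed σ, would break the O(1/N) variance; unknown
beyond equilibrium for any deterministic gas.) [Spohn1991, OllaVaradhanYau1993,
BoldrighiniDobrushinSukhov1983, DoyonEtAl2023]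
#5 AnalyticPreShockPaths (crux) — (card C1 + path connectivity, pure PDE) For data bounds B ≥ 1
there is σ₀(B) such that for σ < σ₀: for every classical hs-Euler solution (ρ, u, θ) on [0,T) with
data in [1/B, B] and ∫ρ(0) = 1 and every t < T there are T' ∈ (t, T] and a family (ρ^δ, u^δ, θ^δ), δ
∈ [0,1], of classical solutions on [0,T') with: member δ = 1 equal to (ρ, u, θ) on [0,T'); constant
data at δ = 0; unit mass and data bounds 2B for all δ; data jointly real-analytic in (δ, x) on [0,1)
× 𝕋³; tested fields ∫χρ^δ(s), ∫χρ^δu^δ(s), ∫χE^δ(s) real-analytic in δ on [0,1) for every s < T' and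
continuous χ; and the family jointly C¹ in (δ, s, x) on [0,1] × [0,t] × 𝕋³. [difficulty: L] (why it
might fail: needs a path from U(0) to a constant INSIDE the open set {T* > t} ∩ {bounds 2B}:
amplitude scaling can shorten the lifespan (focusing), so connectivity of the pre-shock set is a
real question; δ-analyticity up to any t < inf T* needs analytic data and control of the
complexified flow.) [AlinhacMetivier1984, Kato1975, Majda1984, Sideris1985]
#9 LocalGibbsStatics (support) — Low-density statics of the canonical local Gibbs laws of the
conjunct (strengthens the Literature fact localGibbs_lln with identification): for bounds B ≥ 1 and
σ < σ₀(B) there are the local equation of state R = R_σ (density as a function of activity for the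
homogeneous hard-sphere gas; Ruelle1969 Thm 4.2.3) and its inverse, both real-analytic and within
[z/2, 2z] on [0, 4B²] resp. [0, 2B], R strictly increasing, R(0) = 0, such that for continuous
profiles (a, θ₀, u₀) within the bounds there is a chemical potential μ with ∫R(e^μ a) = 1, the laws
are probability measures for all N and flows, and the three empirical fields at time 0 converge in
probability to (R(e^μ a(x)), u₀, θ₀) (LLN with the LOCAL equation of state; cluster expansion in
inhomogeneous activity, LebowitzPenrose1964, Ruelle1969 Ch. 4, Gaussian velocities). [difficulty: L]
[Ruelle1969, LebowitzPenrose1964, LebowitzPenrose1968, Spohn1991]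
#9 VitaliPropagation (support) — Vitali–Porter theorem: a sequence of holomorphic functions on an
open connected U ⊂ ℂ, uniformly bounded on compact subsets, converging pointwise on a set E ⊂ U with
an accumulation point in U, converges locally uniformly on U to a holomorphic limit (Montel via
Arzelà–Ascoli + identity theorem; Mathlib has TendstoLocallyUniformlyOn.differentiableOn and
Arzelà–Ascoli, not Montel). [difficulty: provable-now] [Ruelle1969, LeeYang1952]

TWO-LAYER PLAN. Foreseen glued splits (none filed now): NearEquilibriumLimit ⇐
EquilibriumCumulantIdentification (card B1: for every k the k-th
δ-derivative at 0 of the means — an EQUILIBRIUM (k+1)-point time-displaced cumulant under the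
invariant Gibbs law — converges to the k-th
Euler/BMFT response; k = 0 statics, k = 1 = Spohn1991 (7.18) Landau–Placzek, k ≥ 2 tree responses,
DoyonEtAl2023) → UniformAmplitudeAnalyticity
restricted to a neighbourhood of δ = 0 → NearEquilibriumLimit (Vitali at the origin).
UniformAmplitudeAnalyticity ⇐ StaticZeroFree (Ruelle
4.2.3 for complex activity PROFILES at fixed σ, t = 0) → KineticTimeAnalyticity (t ≤ c·N^(-1/3):
finitely many collisions, dynamical cluster
expansion at fixed σ) → the macroscopic-time statement (the real crux; glue = semigroup/restart in
the complex amplitude, if any).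
AnalyticPreShockPaths ⇐ AnalyticDependence (analytic data path with inf T* > t ⇒ δ-analytic
classical family, AlinhacMetivier1984 +
complexified-parameter Cauchy–Kovalevskaya estimates) → PreShockConnectivity ({T* > t} ∩ bounds is
path-connected to constants through
analytic data; polynomial approximation of continuous paths in the open set) →
AnalyticPreShockPaths.

KILL CRITERIA. Refutation of UniformAmplitudeAnalyticity for some analytic pre-shock path (e.g. an
N-uniform lower bound showing the δ-radius of m_N
shrinks to 0 at a macroscopic time before any shock, or a proof that the time-t large-deviation rate
function of a tested field under
analytic local Gibbs data is non-analytic pre-shock) closes the route: close --reason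
refuted:UniformAmplitudeAnalyticity. ¬NearEquilibriumLimit
(a near-equilibrium counterexample to the hydrodynamic limit) refutes the CONJUNCT near equilibrium
— file ¬HydrodynamicLimitFor and close
every route. ¬FieldVarianceBound with the conjunct still plausible (super-CLT fluctuations
pre-shock) forces a pivot: replace V by
exponential concentration from the κ-analyticity of the space-time pressure (card (A1) strong form)
or by OVY-type entropy bounds.
¬AnalyticPreShockPaths (a classical solution whose data cannot be joined to a constant inside {T* >
t}) forces a pivot to the weaker
theorem "Euler up to T_path = inf_δ T*(δ) along the amplitude segment" (restate C with T_path; the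
conjunct's arbitrary T is then out of
reach of this line alone). NearEquilibriumLimit proved elsewhere (two-time-pressure E4+E2b,
first-failure-blowup crux 1, transient-covariance)
is consumed, not mooting; HydrodynamicLimit proved by any route moots everything.

NOT DECOMPOSED YET. The strong form (A1) of the card (zero-freeness and two-sided e^(±NM) bounds of
the space-time moment generating function
(δ, κ) ↦ E_ψ_δ[e^(κ(N+1)W_t)] on a complex polydomain, which would also give exponential
concentration and make V redundant) — filed
only if V dies; the order-by-order equilibrium cumulant tower B1 (layer-2 children of
NearEquilibriumLimit); the kinetic-time
(t ≲ N^(-1/3)) version of A; HsEosLowDensity-type analyticity of hsExcessFreeEnergy (needed inside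
C's and S's proofs, shared with
stmt-0768 of RelEntropyErgodic, attachable with --supports); measurability/integrability lemmas for
W_t∘Φ_t (provers attach with
--supports Assembly); the shock-time = Lee–Yang-edge prediction (not load-bearing).

CHEAPEST FALSIFIER. (i) Pen and paper, one afternoon: Burgers/p-system caricature — check that for
ANALYTIC data the tested entropy-free solution is
δ-analytic on a complex neighbourhood of [0,1] whose width is ≍ r_x/(c·t) (r_x = x-analyticity
radius) and NOT beyond; if even analytic
data gave zero δ-radius at some t < inf T*, UniformAmplitudeAnalyticity is dead by the heuristic "A
⇒ analytic limit functional"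
(done here for Burgers by characteristics: analytic in δ iff data or test function analytic —
consistent). (ii) kit MD (not run: hub
compute-free for planners): equilibrium hard spheres at σ³ρ = 0.05, N = 10³–10⁵: finite-size scaling
of the third joint cumulant
N²κ₃(W_t; Λ, Λ) for a sinusoidal tilt observable Λ at t = O(1) — growth with N kills A; and
(N+1)·Var_ψ_δ(W_t) at δ = 0.5 vs N — growth kills V.
(iii) Lookup: a printed dynamical Lee–Yang/Fisher-zero result pinching the real TILT axis at finite
macroscopic time for a reversible
deterministic or OVY-noisy gas (searched: none found; Flindt–Garrahan zeros are in counting fields,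
Heyl et al. in complex time).

NUMBERS. Static zero-free radius (Ruelle1969 Thm 4.2.3, hard core B = 0): |z| < e^(-1) C(β)^(-1)
with C(β) = (4π/3)·d³ for spheres of diameter d —
in the conjunct's microscopic units the activity radius is ≍ 0.088/σ³, huge for σ < σ₀, which is why
σ₀(B) exists in A, S at t = 0.
Second virial coefficient: Z(η) = 1 + (2π/3)η + O(η²) (HardSphereEuler.lean docstring; Ruelle1969
§4.3). Collisions per particle per
unit macroscopic time ≍ (N+1)^(1/3) (HardSphereEuler.lean). Lifespan of amplitude-δ smooth data ≳
1/δ (Kato1975/Majda1984 continuation;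
Sideris1985 shows finiteness in 3-D for the polytropic gas). Items at open: 7 (4 cruxes, 2 support,
1 assembly).

DEFINITION REQUESTS. None needed to type the items: localGibbsLaw, TendstoHydroFieldsAt,
IsHardSphereEulerSolution, empiricalMeasure, Torus.stLift/proj,
hsDiameter exist; complex tilts are avoided by stating analytic EXTENSIONS of real-δ means (unique
by the identity theorem), cumulants by
evariance/covariance at finite N. A later definition `spaceTimeMGF σ a u θ N Φ t w (δ κ : ℝ) : ℝ`
(Summits/AtomisticToContinuum/HydrodynamicLimit/Theorems)
would shorten the strong form (A1) if it is ever filed.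

Novelty: Searches (2026-08-15): `lit frontier AtomisticToContinuum --since 2020` (30 rows: DHM follow-ups,
CLO 2026 heat equation, BMFT absent;
nothing on amplitude analyticity); `lit bridges AtomisticToContinuum --cross any` (30 rows; no
complex-analytic transfer); `lit search
--source zbmath` ×4 ("analytic continuation coupling constant nonequilibrium Vitali theorem" 0,
"Lee-Yang zeros dynamical partition
function space-time" 0, "analytic dependence on parameters quasilinear hyperbolic systems" 4
irrelevant, "linear response higher order
analyticity perturbation Gibbs dynamics" 0); `lit search --source crossref` ×6 ("Lee-Yang zeros
dynamical phase transition" →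
doi:10.1103/physreve.88.012119 Hickey–Flindt–Garrahan (trajectory/counting-field zeros),
doi:10.1088/0305-4470/35/21/303; "analyticity
nonlinear response equilibrium time correlations" → Lebowitz LNP doi:10.1007/bfb0013358 (static);
"propagation of analyticity hyperbolic
systems" → AlinhacMetivier1984 doi:10.1007/bf01388563; "Vitali convergence theorem statistical
mechanics" 0 relevant); `lit search --hybrid`
(local: Ruelle1969 pp. 69, 97 read — Thm 4.2.3 and the Vitali step of Thm 5.1.3; Spohn1991 pp. 88–89
read — (7.16)–(7.18)); `lit galaxy
search … --star all` (rc 3, panama queue timeout; pdf/crabby 0 hits); the card's own searches (BMFT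
arXiv:2206.14167, 2504.09201,
2506.05266; dynamical LY zeros arXiv:1209.2524, 1206.2505); all 134 cards of the sub via ledger idea
list (nearest: two-time-pressure-symmetry
E4, equilibrium  [refs: 10.1103/physreve.88.012119, 10.1088/0305-4470/35/21/303, 10.1007/bfb0013358, 10.1007/bf01388563, 2206.14167, 1209.2524, doi:10.1103/physreve.88.012119, doi:10.1088/0305-4470/35/21/303, doi:10.1007/bfb0013358, doi:10.1007/bf01388563, AlinhacMetivier1984, Ruelle1969, Spohn1991, LebowitzPenrose1968, DoyonEtAl2023]

Barriers (technique_class: amplitude-analyticity vitali-transfer dynamical-lee-yang): - technique_class: amplitude-analyticity vitali-transfer dynamical-lee-yang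
- Literature.Barriers.AtomisticToContinuum.BoltzmannHypothesisBarrier: evaded in form — no
classification of stationary states of the infinite dynamics is used; the only stationary law is the
finite-N canonical Gibbs law (base point of the tilt family). Conceded in substance: the ergodic
content reappears as NearEquilibriumLimit (relaxation of small perturbations of Gibbs) and inside
UniformAmplitudeAnalyticity; the barrier's ideal-gas kernel is respected (for free flight B is false
— velocity laws do not relax — so the line proves nothing there, as it must).
- Literature.Barriers.AtomisticToContinuum.NoDensityExpansionBarrier: not met — no expansion in the
density and no term-by-term t → ∞ limit of isolated-group dynamics; the expansion variable is the
tilt amplitude at FIXED σ, and the Two-layer plan states explicitly that any smoothness-blind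
cluster expansion cannot prove A at macroscopic times (the δ-radius must see the x-analyticity
radius), so the barrier's divergences are not even approached.
- Literature.Barriers.AtomisticToContinuum.DiluteRegimeBarrier: not met — (N+1)ε³ = σ³ fixed
throughout, full hs equation of state via LocalGibbsStatics/R_σ; σ₀(B) small is the conjunct's own
quantifier.
- Literature.Barriers.AtomisticToContinuum.HighMomentumCutoffBarrier: not met at the level of
statements — only means and variances of observables with |w| ≤ C(1+|v|²) occur, finite by Gaussian
velocities

History (route lifecycle, newest last):
- 2026-08-15T13:38:27Z · CLOSED retired — not-a-thesis: assembly does not conclude the sub-problem Statement (operator:999:1257524)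

sub-problem: HydrodynamicLimit · status: closed(retired) · opened planner-plancard-AtomisticToContinuum-Hydrody-8a105f44-0 2026-08-15T11:41:50Z · rev 0 · ledger route-AtomisticToContinuum-AmplitudeAnalyticity
GENERATED by the gate from the ledger (D-0016/17). Provers cite these decls: `theorem foo : Summit.AtomisticToContinuum.HydrodynamicLimit.Theses.AmplitudeAnalyticity.<Decl> := …` in Summits/AtomisticToContinuum/HydrodynamicLimit/Theorems/<Name>.lean.
-/

namespace Summit.AtomisticToContinuum.HydrodynamicLimit.Theses.AmplitudeAnalyticity

open scoped BigOperators Topology Manifold Classical MeasureTheory ProbabilityTheory Matrix InnerProductSpace ComplexConjugate ContinuousMap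
open Filter Set Function TopologicalSpace MeasureTheory

attribute [summit_statement] _root_.HydrodynamicLimit

/-- item stmt-AtomisticToContinuum-5609 · crux · rank 2 · closed · moot by None · by planner
why it might fail: an N-uniform COMPLEX-tilt large-deviation statement over ≍N^(1/3) collision times: a real pinch of zeros of δ ↦ E_G[e^Λ(δ) W_t] (dynamical phase transition, hidden slow mode) before T' kills it; the δ-radius must shrink with the x-analyticity radius, so no smoothness-blind expansion proves it.
sources: Ruelle1969, LeeYang1952, LebowitzPenrose1968, Spohn1991, DoyonEtAl2023, OllaVaradhanYau1993
[crux] (card A1, weakest sufficient form) For profile bounds B ≥ 1 there is σ₀(B) such that for σ <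
σ₀, every path of local-Gibbs profiles (a, u, θ)_δ jointly real-analytic in (δ, x) on [0,1] × 𝕋³
(through Torus.stLift) within the bounds, every family of classical hs-Euler solutions on [0,T')
LLN-matched to it at time 0 for all δ ∈ [0,1], every flow family, every t < T' and every continuous
one-body observable w with |w(x,v)| ≤ C_w(1+|v|²): there are r > 0 and M such that for every N the
mean δ ↦ E_ψ_δ^N[∫ w dμ^emp(Φ^N_t z)] is the restriction to [0,1] of a holomorphic function bounded
by M on the r-neighbourhood of [0,1] ⊂ ℂ. [difficulty: open-problem] -/
@[route_item "route-AtomisticToContinuum-AmplitudeAnalyticity"]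
def UniformAmplitudeAnalyticity : Prop :=
  ∀ B : ℝ, 1 ≤ B → ∃ σ₀ : ℝ, 0 < σ₀ ∧ ∀ σ : ℝ, 0 < σ → σ < σ₀ → ∀ (a θp : ℝ → Literature.MathematicalPhysics.KineticTheory.T3 → ℝ) (up : ℝ → Literature.MathematicalPhysics.KineticTheory.T3 → Literature.MathematicalPhysics.KineticTheory.V3), AnalyticOnNhd ℝ (Literature.Analysis.FunctionSpaces.Torus.stLift a) (Set.Icc 0 1 ×ˢ Set.univ) → AnalyticOnNhd ℝ (Literature.Analysis.FunctionSpaces.Torus.stLift θp) (Set.Icc 0 1 ×ˢ Set.univ) → AnalyticOnNhd ℝ (Literature.Analysis.FunctionSpaces.Torus.stLift up) (Set.Icc 0 1 ×ˢ Set.univ) → (∀ δ ∈ Set.Icc (0:ℝ) 1, ∀ x, B⁻¹ ≤ a δ x ∧ a δ x ≤ B ∧ B⁻¹ ≤ θp δ x ∧ θp δ x ≤ B ∧ ‖up δ x‖ ≤ B) → ∀ (T' : ℝ) (ρE θE : ℝ → ℝ → Literature.MathematicalPhysics.KineticTheory.T3 → ℝ) (uE : ℝ → ℝ → Literature.MathematicalPhysics.KineticTheory.T3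 → Literature.MathematicalPhysics.KineticTheory.V3), (∀ δ ∈ Set.Icc (0:ℝ) 1, Literature.MathematicalPhysics.KineticTheory.IsHardSphereEulerSolution σ T' (ρE δ) (uE δ) (θE δ)) → ∀ Φ : (N : ℕ) → Literature.Analysis.FluidPDE.HardSphereFlow (Literature.Analysis.FluidPDE.Torus.geometry (Fin 3)) (Literature.MathematicalPhysics.KineticTheory.hsDiameter σ N) (N + 1), (∀ δ ∈ Set.Icc (0:ℝ) 1, (∀ N, MeasureTheory.IsProbabilityMeasure (Literature.MathematicalPhysics.KineticTheory.localGibbsLaw σ (a δ) (up δ) (θp δ) N (Φ N))) ∧ Literature.MathematicalPhysics.KineticTheory.TendstoHydroFieldsAt (fun N => Literature.MathematicalPhysics.KineticTheory.localGibbsLaw σ (a δ) (up δ) (θp δ) N (Φ N)) Φ (ρE δ) (uE δ) (θE δ) 0) → ∀ t ∈ Set.Ico 0 T', ∀ w : Literature.MathematicalPhysics.KineticTheory.T3 × Literature.MathematicalPhysics.KineticTheory.V3 → ℝ, Continuous w → (∃ Cw : ℝ, ∀ y, |w y| ≤ Cw * (1 + ‖y.2‖ ^ 2)) → ∃ r :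 ℝ, 0 < r ∧ ∃ M : ℝ, ∀ N : ℕ, ∃ g : ℂ → ℂ, DifferentiableOn ℂ g (Metric.thickening r (Complex.ofReal '' Set.Icc (0:ℝ) 1)) ∧ (∀ ζ ∈ Metric.thickening r (Complex.ofReal '' Set.Icc (0:ℝ) 1), ‖g ζ‖ ≤ M) ∧ ∀ δ ∈ Set.Icc (0:ℝ) 1, g (δ : ℂ) = ((∫ z, (∫ y, w y ∂(Literature.Analysis.FluidPDE.empiricalMeasure ((Φ N).flow t z))) ∂(Literature.MathematicalPhysics.KineticTheory.localGibbsLaw σ (a δ) (up δ) (θp δ) N (Φ N)) : ℝ) : ℂ)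

/-- item stmt-AtomisticToContinuum-5610 · crux · rank 3 · closed · moot by None · by planner
why it might fail: still a hydrodynamic limit for deterministic hard spheres: needs decay over N^(1/3) collision times of the non-hydrodynamic part of a small perturbation of Gibbs (no linear-response/spectral theorem for the N-body Liouvillian at fixed σ; even Spohn1991 (7.13) is open); a hidden slow mode breaks it.
sources: Spohn1991, OllaVaradhanYau1993, Yau1991, TothValko2003, DoyonEtAl2023
[crux] (card B1') Same frame as UniformAmplitudeAnalyticity plus constant profiles at δ = 0 (global
equilibrium): there is δ₁ > 0 such that for every δ ∈ [0, δ₁) and every t < T' the empirical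
density, momentum and energy fields at time t converge in probability (TendstoHydroFieldsAt) under
ψ_δ^N to the matched classical Euler solution — the conjunct restricted to small-amplitude analytic
perturbations of global equilibrium. [difficulty: open-problem] -/
@[route_item "route-AtomisticToContinuum-AmplitudeAnalyticity"]
def NearEquilibriumLimit : Prop :=
  ∀ B : ℝ, 1 ≤ B → ∃ σ₀ : ℝ, 0 < σ₀ ∧ ∀ σ : ℝ, 0 < σ → σ < σ₀ → ∀ (a θp : ℝ → Literature.MathematicalPhysics.KineticTheory.T3 → ℝ) (up : ℝ → Literature.MathematicalPhysics.KineticTheory.T3 → Literature.MathematicalPhysics.KineticTheory.V3), AnalyticOnNhd ℝ (Literature.Analysis.FunctionSpaces.Torus.stLift a) (Set.Icc 0 1 ×ˢ Set.univ) → AnalyticOnNhd ℝ (Literature.Analysis.FunctionSpaces.Torus.stLift θp) (Set.Icc 0 1 ×ˢ Set.univ) → AnalyticOnNhd ℝ (Literature.Analysis.FunctionSpaces.Torus.stLift up) (Set.Icc 0 1 ×ˢ Set.univ) → (∀ δ ∈ Set.Icc (0:ℝ) 1, ∀ x, B⁻¹ ≤ a δ x ∧ a δ x ≤ B ∧ B⁻¹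 ≤ θp δ x ∧ θp δ x ≤ B ∧ ‖up δ x‖ ≤ B) → (∀ x y, a 0 x = a 0 y ∧ θp 0 x = θp 0 y ∧ up 0 x = up 0 y) → ∀ (T' : ℝ) (ρE θE : ℝ → ℝ → Literature.MathematicalPhysics.KineticTheory.T3 → ℝ) (uE : ℝ → ℝ → Literature.MathematicalPhysics.KineticTheory.T3 → Literature.MathematicalPhysics.KineticTheory.V3), (∀ δ ∈ Set.Icc (0:ℝ) 1, Literature.MathematicalPhysics.KineticTheory.IsHardSphereEulerSolution σ T' (ρE δ) (uE δ) (θE δ)) → ∀ Φ : (N : ℕ) → Literature.Analysis.FluidPDE.HardSphereFlow (Literature.Analysis.FluidPDE.Torus.geometry (Fin 3)) (Literature.MathematicalPhysics.KineticTheory.hsDiameter σ N) (N + 1), (∀ δ ∈ Set.Icc (0:ℝ) 1, (∀ N, MeasureTheory.IsProbabilityMeasure (Literature.MathematicalPhysics.KineticTheory.localGibbsLaw σ (a δ) (up δ) (θp δ) N (Φ N))) ∧ Literature.MathematicalPhysics.KineticTheory.TendstoHydroFieldsAt (fun N => Literature.MathematicalPhysics.KineticTheory.localGibbsLaw σ (a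 δ) (up δ) (θp δ) N (Φ N)) Φ (ρE δ) (uE δ) (θE δ) 0) → ∃ δ₁ : ℝ, 0 < δ₁ ∧ ∀ δ ∈ Set.Ico (0:ℝ) δ₁, ∀ t ∈ Set.Ico 0 T', Literature.MathematicalPhysics.KineticTheory.TendstoHydroFieldsAt (fun N => Literature.MathematicalPhysics.KineticTheory.localGibbsLaw σ (a δ) (up δ) (θp δ) N (Φ N)) Φ (ρE δ) (uE δ) (θE δ) t

/-- item stmt-AtomisticToContinuum-5611 · crux · rank 4 · closed · moot by None · by planner
why it might fail: for δ > 0 no change-of-measure argument survives (dψ_δ/dG ~ e^(O(δN))); an instability of the Euler background amplifying thermal noise beyond N^(-1/2), or anomalous growth of dynamical correlations at fixed σ, would break the O(1/N) variance; unknown beyond equilibrium for any deterministic gas.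
sources: Spohn1991, OllaVaradhanYau1993, BoldrighiniDobrushinSukhov1983, DoyonEtAl2023
[crux] For profile bounds B ≥ 1 there is σ₀(B) such that for σ < σ₀, along every path of profiles
jointly C¹ in (δ, x) on [0,1] × 𝕋³ within the bounds, with a family of classical solutions on [0,T')
LLN-matched for all δ and jointly C¹ in (δ, s, x) on [0,1] × [0,t] × 𝕋³, for every t ∈ [0,T') and
growth constant C_w there is C with (N+1)·eVar_ψ_δ^N(∫ w dμ^emp(Φ^N_t z)) ≤ C for all continuous w
with |w| ≤ C_w(1+|v|²), all N and all δ ∈ [0,1]: CLT-size fluctuations of one-body empirical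
observables persist to Euler times, uniformly along compact C¹ pre-shock families (at t = 0 or δ = 0
this is statics by invariance of the Gibbs law). [difficulty: open-problem] -/
@[route_item "route-AtomisticToContinuum-AmplitudeAnalyticity"]
def FieldVarianceBound : Prop :=
  ∀ B : ℝ, 1 ≤ B → ∃ σ₀ : ℝ, 0 < σ₀ ∧ ∀ σ : ℝ, 0 < σ → σ < σ₀ → ∀ (a θp : ℝ → Literature.MathematicalPhysics.KineticTheory.T3 → ℝ) (up : ℝ → Literature.MathematicalPhysics.KineticTheory.T3 → Literature.MathematicalPhysics.KineticTheory.V3), ContDiffOn ℝ 1 (Literature.Analysis.FunctionSpaces.Torus.stLift a) (Set.Icc 0 1 ×ˢ Set.univ) → ContDiffOn ℝ 1 (Literature.Analysis.FunctionSpaces.Torus.stLift θp) (Set.Icc 0 1 ×ˢ Set.univ) → ContDiffOn ℝ 1 (Literature.Analysis.FunctionSpaces.Torus.stLift up) (Set.Icc 0 1 ×ˢ Set.univ) → (∀ δ ∈ Set.Icc (0:ℝ) 1, ∀ x, B⁻¹ ≤ a δ x ∧ a δ x ≤ B ∧ B⁻¹ ≤ θp δ x ∧ θp δ x ≤ B ∧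 ‖up δ x‖ ≤ B) → ∀ (T' : ℝ) (ρE θE : ℝ → ℝ → Literature.MathematicalPhysics.KineticTheory.T3 → ℝ) (uE : ℝ → ℝ → Literature.MathematicalPhysics.KineticTheory.T3 → Literature.MathematicalPhysics.KineticTheory.V3), (∀ δ ∈ Set.Icc (0:ℝ) 1, Literature.MathematicalPhysics.KineticTheory.IsHardSphereEulerSolution σ T' (ρE δ) (uE δ) (θE δ)) → ∀ Φ : (N : ℕ) → Literature.Analysis.FluidPDE.HardSphereFlow (Literature.Analysis.FluidPDE.Torus.geometry (Fin 3)) (Literature.MathematicalPhysics.KineticTheory.hsDiameter σ N) (N + 1), (∀ δ ∈ Set.Icc (0:ℝ) 1, (∀ N, MeasureTheory.IsProbabilityMeasure (Literature.MathematicalPhysics.KineticTheory.localGibbsLaw σ (a δ) (up δ) (θp δ) N (Φ N))) ∧ Literature.MathematicalPhysics.KineticTheory.TendstoHydroFieldsAt (fun N => Literature.MathematicalPhysics.KineticTheory.localGibbsLaw σ (a δ) (up δ) (θp δ) N (Φ N)) Φ (ρE δ) (uE δ) (θE δ) 0) → ∀ t ∈ Set.Ico 0 T', ContDiffOn ℝ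 1 (fun p : ℝ × ℝ × EuclideanSpace ℝ (Fin 3) => ρE p.1 p.2.1 (Literature.Analysis.FunctionSpaces.Torus.proj p.2.2)) (Set.Icc 0 1 ×ˢ Set.Icc 0 t ×ˢ Set.univ) → ContDiffOn ℝ 1 (fun p : ℝ × ℝ × EuclideanSpace ℝ (Fin 3) => θE p.1 p.2.1 (Literature.Analysis.FunctionSpaces.Torus.proj p.2.2)) (Set.Icc 0 1 ×ˢ Set.Icc 0 t ×ˢ Set.univ) → ContDiffOn ℝ 1 (fun p : ℝ × ℝ × EuclideanSpace ℝ (Fin 3) => uE p.1 p.2.1 (Literature.Analysis.FunctionSpaces.Torus.proj p.2.2)) (Set.Icc 0 1 ×ˢ Set.Icc 0 t ×ˢ Set.univ) → ∀ Cw : ℝ, ∃ C : ℝ, ∀ w : Literature.MathematicalPhysics.KineticTheory.T3 × Literature.MathematicalPhysics.KineticTheory.V3 → ℝ, Continuous w → (∀ y, |w y| ≤ Cw * (1 + ‖y.2‖ ^ 2)) → ∀ N : ℕ, ∀ δ ∈ Set.Icc (0:ℝ) 1, ((N : ENNReal) + 1) * ProbabilityTheory.evariance (fun z => ∫ y, w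 y ∂(Literature.Analysis.FluidPDE.empiricalMeasure ((Φ N).flow t z))) (Literature.MathematicalPhysics.KineticTheory.localGibbsLaw σ (a δ) (up δ) (θp δ) N (Φ N)) ≤ ENNReal.ofReal C

/-- item stmt-AtomisticToContinuum-5612 · crux · rank 5 · closed · moot by None · by planner
why it might fail: needs a path from U(0) to a constant INSIDE the open set {T* > t} ∩ {bounds 2B}: amplitude scaling can shorten the lifespan (focusing), so connectivity of the pre-shock set is a real question; δ-analyticity up to any t < inf T* needs analytic data and control of the complexified flow.
sources: AlinhacMetivier1984, Kato1975, Majda1984, Sideris1985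
[crux] (card C1 + path connectivity, pure PDE) For data bounds B ≥ 1 there is σ₀(B) such that for σ
< σ₀: for every classical hs-Euler solution (ρ, u, θ) on [0,T) with data in [1/B, B] and ∫ρ(0) = 1
and every t < T there are T' ∈ (t, T] and a family (ρ^δ, u^δ, θ^δ), δ ∈ [0,1], of classical
solutions on [0,T') with: member δ = 1 equal to (ρ, u, θ) on [0,T'); constant data at δ = 0; unit
mass and data bounds 2B for all δ; data jointly real-analytic in (δ, x) on [0,1) × 𝕋³; tested fields
∫χρ^δ(s), ∫χρ^δu^δ(s), ∫χE^δ(s) real-analytic in δ on [0,1) for every s < T' and continuous χ; and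
the family jointly C¹ in (δ, s, x) on [0,1] × [0,t] × 𝕋³. [difficulty: L] -/
@[route_item "route-AtomisticToContinuum-AmplitudeAnalyticity"]
def AnalyticPreShockPaths : Prop :=
  ∀ B : ℝ, 1 ≤ B → ∃ σ₀ : ℝ, 0 < σ₀ ∧ ∀ σ : ℝ, 0 < σ → σ < σ₀ → ∀ (T : ℝ) (ρ θ : ℝ → Literature.MathematicalPhysics.KineticTheory.T3 → ℝ) (u : ℝ → Literature.MathematicalPhysics.KineticTheory.T3 → Literature.MathematicalPhysics.KineticTheory.V3), Literature.MathematicalPhysics.KineticTheory.IsHardSphereEulerSolution σ T ρ u θ → (∀ x, B⁻¹ ≤ ρ 0 x ∧ ρ 0 x ≤ B ∧ B⁻¹ ≤ θ 0 x ∧ θ 0 x ≤ B ∧ ‖u 0 x‖ ≤ B) → (∫ x, ρ 0 x = 1) → ∀ t ∈ Set.Ico 0 T, ∃ T' : ℝ, t < T' ∧ T' ≤ T ∧ ∃ (ρE θE : ℝ → ℝ → Literature.MathematicalPhysics.KineticTheory.T3 → ℝ) (uE : ℝ → ℝ → Literature.MathematicalPhysics.KineticTheory.T3 → Literature.MathematicalPhysics.KineticTheory.V3),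 (∀ δ ∈ Set.Icc (0:ℝ) 1, Literature.MathematicalPhysics.KineticTheory.IsHardSphereEulerSolution σ T' (ρE δ) (uE δ) (θE δ)) ∧ (∀ s ∈ Set.Ico 0 T', ρE 1 s = ρ s ∧ uE 1 s = u s ∧ θE 1 s = θ s) ∧ (∀ x y, ρE 0 0 x = ρE 0 0 y ∧ uE 0 0 x = uE 0 0 y ∧ θE 0 0 x = θE 0 0 y) ∧ (∀ δ ∈ Set.Icc (0:ℝ) 1, (∫ x, ρE δ 0 x = 1) ∧ ∀ x, (2 * B)⁻¹ ≤ ρE δ 0 x ∧ ρE δ 0 x ≤ 2 * B ∧ (2 * B)⁻¹ ≤ θE δ 0 x ∧ θE δ 0 x ≤ 2 * B ∧ ‖uE δ 0 x‖ ≤ 2 * B) ∧ AnalyticOnNhd ℝ (Literature.Analysis.FunctionSpaces.Torus.stLift (fun δ => ρE δ 0)) (Set.Ico 0 1 ×ˢ Set.univ) ∧ AnalyticOnNhd ℝ (Literature.Analysis.FunctionSpaces.Torus.stLift (fun δ => θE δ 0)) (Set.Ico 0 1 ×ˢ Set.univ) ∧ AnalyticOnNhd ℝ (Literature.Analysis.FunctionSpaces.Torus.stLift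 (fun δ => uE δ 0)) (Set.Ico 0 1 ×ˢ Set.univ) ∧ (∀ s ∈ Set.Ico 0 T', ∀ χ : Literature.MathematicalPhysics.KineticTheory.T3 → ℝ, Continuous χ → AnalyticOnNhd ℝ (fun δ => ∫ x, χ x * ρE δ s x) (Set.Ico 0 1) ∧ AnalyticOnNhd ℝ (fun δ => ∫ x, (χ x * ρE δ s x) • uE δ s x) (Set.Ico 0 1) ∧ AnalyticOnNhd ℝ (fun δ => ∫ x, χ x * Literature.MathematicalPhysics.KineticTheory.totalEnergyDensity (ρE δ s x) (uE δ s x) (θE δ s x)) (Set.Ico 0 1)) ∧ ContDiffOn ℝ 1 (fun p : ℝ × ℝ × EuclideanSpace ℝ (Fin 3) => ρE p.1 p.2.1 (Literature.Analysis.FunctionSpaces.Torus.proj p.2.2)) (Set.Icc 0 1 ×ˢ Set.Icc 0 t ×ˢ Set.univ) ∧ ContDiffOn ℝ 1 (fun p : ℝ × ℝ × EuclideanSpace ℝ (Fin 3) => θE p.1 p.2.1 (Literature.Analysis.FunctionSpaces.Torus.proj p.2.2)) (Set.Icc 0 1 ×ˢ Set.Icc 0 t ×ˢ Set.univ) ∧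 ContDiffOn ℝ 1 (fun p : ℝ × ℝ × EuclideanSpace ℝ (Fin 3) => uE p.1 p.2.1 (Literature.Analysis.FunctionSpaces.Torus.proj p.2.2)) (Set.Icc 0 1 ×ˢ Set.Icc 0 t ×ˢ Set.univ)

/-- item stmt-AtomisticToContinuum-5613 · support · rank 9 · closed · moot by None · by planner
sources: Ruelle1969, LebowitzPenrose1964, LebowitzPenrose1968, Spohn1991
[support] Low-density statics of the canonical local Gibbs laws of the conjunct (strengthens the
Literature fact localGibbs_lln with identification): for bounds B ≥ 1 and σ < σ₀(B) there are the
local equation of state R = R_σ (density as a function of activity for the homogeneous hard-sphere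
gas; Ruelle1969 Thm 4.2.3) and its inverse, both real-analytic and within [z/2, 2z] on [0, 4B²]
resp. [0, 2B], R strictly increasing, R(0) = 0, such that for continuous profiles (a, θ₀, u₀) within
the bounds there is a chemical potential μ with ∫R(e^μ a) = 1, the laws are probability measures for
all N and flows, and the three empirical fields at time 0 converge in probability to (R(e^μ a(x)),
u₀, θ₀) (LLN with the LOCAL equation of state; cluster expansion in inhomogeneous activity,
LebowitzPenrose1964, Ruelle1969 Ch. 4, Gaussian velocities). [difficulty: L] -/
@[route_item "route-AtomisticToContinuum-AmplitudeAnalyticity"]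
def LocalGibbsStatics : Prop :=
  ∀ B : ℝ, 1 ≤ B → ∃ σ₀ : ℝ, 0 < σ₀ ∧ ∀ σ : ℝ, 0 < σ → σ < σ₀ → ∃ R Rinv : ℝ → ℝ, AnalyticOnNhd ℝ R (Set.Icc 0 (4 * B ^ 2)) ∧ AnalyticOnNhd ℝ Rinv (Set.Icc 0 (4 * B ^ 2)) ∧ StrictMonoOn R (Set.Icc 0 (4 * B ^ 2)) ∧ R 0 = 0 ∧ (∀ z ∈ Set.Icc (0:ℝ) (4 * B ^ 2), Rinv (R z) = z ∧ z / 2 ≤ R z ∧ R z ≤ 2 * z) ∧ (∀ y ∈ Set.Icc (0:ℝ) (2 * B), R (Rinv y) = y ∧ y / 2 ≤ Rinv y ∧ Rinv y ≤ 2 * y) ∧ ∀ (a θ₀ : Literature.MathematicalPhysics.KineticTheory.T3 → ℝ) (u₀ : Literature.MathematicalPhysics.KineticTheory.T3 → Literature.MathematicalPhysics.KineticTheory.V3), Continuous a → Continuous θ₀ → Continuous u₀ → (∀ x, B⁻¹ ≤ a x ∧ a x ≤ B ∧ B⁻¹ ≤ θ₀ x ∧ θ₀ x ≤ B ∧ ‖u₀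 x‖ ≤ B) → ∃ μ : ℝ, (∫ x, R (Real.exp μ * a x) = 1) ∧ (∀ x, Real.exp μ * a x ∈ Set.Icc (0:ℝ) (4 * B ^ 2)) ∧ ∀ Φ : (N : ℕ) → Literature.Analysis.FluidPDE.HardSphereFlow (Literature.Analysis.FluidPDE.Torus.geometry (Fin 3)) (Literature.MathematicalPhysics.KineticTheory.hsDiameter σ N) (N + 1), (∀ N, MeasureTheory.IsProbabilityMeasure (Literature.MathematicalPhysics.KineticTheory.localGibbsLaw σ a u₀ θ₀ N (Φ N))) ∧ Literature.MathematicalPhysics.KineticTheory.TendstoHydroFieldsAt (fun N => Literature.MathematicalPhysics.KineticTheory.localGibbsLaw σ a u₀ θ₀ N (Φ N)) Φ (fun _ x => R (Real.exp μ * a x)) (fun _ => u₀) (fun _ => θ₀) 0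

/-- item stmt-AtomisticToContinuum-5614 · support · rank 9 · closed · moot by None · by planner
sources: Ruelle1969, LeeYang1952
[support] Vitali–Porter theorem: a sequence of holomorphic functions on an open connected U ⊂ ℂ,
uniformly bounded on compact subsets, converging pointwise on a set E ⊂ U with an accumulation point
in U, converges locally uniformly on U to a holomorphic limit (Montel via Arzelà–Ascoli + identity
theorem; Mathlib has TendstoLocallyUniformlyOn.differentiableOn and Arzelà–Ascoli, not Montel).
[difficulty: provable-now] -/
@[route_item "route-AtomisticToContinuum-AmplitudeAnalyticity"]
def VitaliPropagation : Prop :=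
  ∀ (U : Set ℂ), IsOpen U → IsConnected U → ∀ (F : ℕ → ℂ → ℂ), (∀ n, DifferentiableOn ℂ (F n) U) → (∀ K ⊆ U, IsCompact K → ∃ M : ℝ, ∀ n, ∀ z ∈ K, ‖F n z‖ ≤ M) → ∀ (E : Set ℂ) (z₀ : ℂ), E ⊆ U → z₀ ∈ U → AccPt z₀ (Filter.principal E) → (∀ z ∈ E, ∃ l : ℂ, Filter.Tendsto (fun n => F n z) Filter.atTop (nhds l)) → ∃ G : ℂ → ℂ, DifferentiableOn ℂ G U ∧ TendstoLocallyUniformlyOn F G Filter.atTop U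

/-- item stmt-AtomisticToContinuum-5615 · assembly · rank 1 · closed · moot by None · by planner
sources: Ruelle1969, Spohn1991, OllaVaradhanYau1993
[assembly] UniformAmplitudeAnalyticity → NearEquilibriumLimit → FieldVarianceBound →
AnalyticPreShockPaths → LocalGibbsStatics → VitaliPropagation → HydrodynamicLimit. -/
@[route_item "route-AtomisticToContinuum-AmplitudeAnalyticity"]
def Assembly : Prop :=
  UniformAmplitudeAnalyticity → NearEquilibriumLimit → FieldVarianceBound → AnalyticPreShockPaths → LocalGibbsStatics → VitaliPropagation → Literature.MathematicalPhysics.KineticTheory.HydrodynamicLimit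

end Summit.AtomisticToContinuum.HydrodynamicLimit.Theses.AmplitudeAnalyticity
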